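import Literature.Topology.FourManifolds.BoundaryPlanarisationCores
import Literature.Topology.FourManifolds.TracePolarRigid
import HarnessLib

/-!
# Planarisation of the boundary: the blow-up picture near the trace circles

Topic `Literature/Topology/FourManifolds` (support for the Torelli half of Griffiths' handlebody
theorem, `stmt-SmoothPoincare4-15190`, after `BoundaryPlanarisationCores.lean`; Dehn/wave part,
D1 third file).  Everything here is **proved**; no definitions.

Milnor, *Lectures on the h-cobordism theorem* (1965), proof of Thm. 3.12 (PDF p. 18): inside a
Milnor box the flow is the model flow `(x₁, y⃗) ↦ (e^{-t} x₁, e^{t} y⃗)`, along which the products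
`x₁ yᵢ` are conserved.  Consequently the trajectory through the point of the **exit sheet** with
flow-polar coordinates `w` (`TracePolarModel.hypPoint`, `x₁ = ε (r - r⁻¹)/2`, `r = ‖w‖ ≠ 1`)
crosses the **entrance sheet** at the point `(± √(ε² + x₁²); |x₁| · w/‖w‖)` of the end `sign x₁`
(`TracePolar.milnorFlow_hypPoint_eq_entPoint`), and in the planarisation of
`BoundaryPlanarisation.lean`

* `SaddleData.planar_pol` — **`planar (pol_s w) = entDir s b (|x₁(w)| · w/‖w‖)`**, `b = (1 < ‖w‖)`:
  read through the flow-polar chart about the trace circle of `s`, the planarisation is the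
  *blow-down* of the unit circle onto the two core directions — the outer collar `{‖w‖ > 1}` goes
  to a punctured neighbourhood of the `+` core direction, the inner collar to one of the `-` core
  direction, radially with radius `|x₁(w)|` and the angle of `w`.

This is the local model of `∂W` about a belt circle as seen on the small level sphere: the
sphere with the `2g` core directions blown up to circles, the two circles of each saddle glued.

## References

* J. Milnor, *Lectures on the h-cobordism theorem* (1965), Def. 3.9, proof of Thm. 3.12, Thm. 4.1
  (PDF pp. 16–22). [MilnorHCobordism1965]
-/

open scoped Manifold ContDiff Topology
open Set Function Filter Metric

noncomputable section

namespace Literature.Topology.FourManifolds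

open Cobordism FourManifolds.Flow

universe u

namespace TracePolar

/-- Local notation for the model plane and space. -/
local notation "E2" => EuclideanSpace ℝ (Fin 2)
local notation "E3" => EuclideanSpace ℝ (Fin 3)

/-! ### The passage from the exit sheet back to the entrance sheet in the model -/

variable {ε : ℝ}

/-- **`x₁ > 0` exactly on the outer collar `{‖w‖ > 1}`.** [folklore] -/
theorem xco_pos_iff (hε : 0 < ε) {w : E2} (hw : w ≠ 0) : 0 < xco ε w ↔ 1 < ‖w‖ := by
  have hr : 0 < ‖w‖ := norm_pos_iff.2 hw
  unfold xco
  constructor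
  · intro h
    have h1 : 0 < ‖w‖ - ‖w‖⁻¹ := by nlinarith
    by_contra hle
    have h2 : ‖w‖ ≤ 1 := not_lt.1 hle
    have h3 : 1 ≤ ‖w‖⁻¹ := one_le_inv_iff₀.2 ⟨hr, h2⟩
    linarith
  · intro h
    have h3 : ‖w‖⁻¹ < 1 := inv_lt_one_of_one_lt₀ h
    nlinarith

/-- The norm of the transverse entrance coordinate `|x₁| · w/‖w‖` is `|x₁|`. [folklore] -/
theorem norm_abs_xco_smul {w : E2} (hw : w ≠ 0) : ‖|xco ε w| • ‖w‖⁻¹ • w‖ = |xco ε w| := by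
  have hr : ‖w‖ ≠ 0 := norm_ne_zero_iff.2 hw
  rw [norm_smul, norm_smul, Real.norm_eq_abs, abs_abs, Real.norm_eq_abs, abs_inv, abs_norm, inv_mul_cancel₀ hr, mul_one]

/-- `‖y⃗ (hypPoint w)‖ = √(ε² + x₁²)`. [folklore] -/
theorem norm_yv_hypPoint_eq_sqrt (hε : 0 < ε) {w : E2} (hw : w ≠ 0) :
    ‖yv (hypPoint ε w)‖ = Real.sqrt (ε ^ 2 + xco ε w ^ 2) := by
  have h := norm_yv_sq_of_sheet (milnorQuadratic_hypPoint hε hw)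
  rw [hypPoint_apply_zero] at h
  rw [← h, Real.sqrt_sq (norm_nonneg _)]

/-- **The model passage**: flowing the exit-sheet point with flow-polar coordinates `w` backward
for the time `log (|x₁| / ‖y⃗‖)` lands on the entrance-sheet point of the end `sign x₁` with
transverse coordinate `|x₁| · w/‖w‖` (`x₁ ≠ 0`). [cite: MilnorHCobordism1965, proof of Thm. 3.12 (PDF p. 18)] -/
theorem milnorFlow_hypPoint_eq_entPoint (hε : 0 < ε) {w : E2} (hw : w ≠ 0) (hx : xco ε w ≠ 0) :
    milnorFlow 1 (Real.log (|xco ε w| / ‖yv (hypPoint ε w)‖)) (hypPoint ε w) =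
      entPoint ε (decide (0 < xco ε w)) (|xco ε w| • ‖w‖⁻¹ • w) := by
  have hr : 0 < ‖w‖ := norm_pos_iff.2 hw
  set x₁ := xco ε w with hx₁
  set Y := ‖yv (hypPoint ε w)‖ with hY
  have hY0 : 0 < Y := norm_yv_pos_of_sheet hε (milnorQuadratic_hypPoint hε hw)
  have hYs : Y = Real.sqrt (ε ^ 2 + x₁ ^ 2) := norm_yv_hypPoint_eq_sqrt hε hw
  have hax : 0 < |x₁| := abs_pos.2 hx
  have hexp : Real.exp (Real.log (|x₁| / Y)) = |x₁| / Y := Real.exp_log (div_pos hax hY0)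
  have hexp' : Real.exp (-Real.log (|x₁| / Y)) = Y / |x₁| := by
    rw [Real.exp_neg, hexp, inv_div]
  -- `yfac · ‖w‖ = Y`
  have hyf : yfac ε w * ‖w‖ = Y := by
    rw [hY, norm_yv_hypPoint hε hw, yfac]; field_simp
  have hn : ‖|x₁| • ‖w‖⁻¹ • w‖ = |x₁| := norm_abs_xco_smul hw
  have hyf0 : yfac ε w ≠ 0 := (yfac_pos hε hw).ne'
  have hw0 : ‖w‖ ≠ 0 := hr.ne'
  ext i
  rw [milnorFlow_apply]
  fin_cases i
  · -- the `x₁`-coordinate: `(Y/|x₁|) x₁ = ± √(ε² + x₁²)`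
    simp only [Fin.zero_eta, Fin.isValue, Nat.lt_one_iff, ite_true, hypPoint_apply_zero, entPoint_apply_zero]
    rw [hexp', hn, sq_abs, ← hYs, ← hx₁]
    by_cases hpos : 0 < x₁
    · rw [decide_eq_true hpos, boolSign_true, abs_of_pos hpos]; field_simp
    · have hneg : x₁ < 0 := lt_of_le_of_ne (not_lt.1 hpos) hx
      rw [decide_eq_false hpos, boolSign_false, abs_of_neg hneg]; field_simp
  · -- the `y₁`-coordinate
    simp only [Fin.mk_one, Fin.isValue, Nat.lt_irrefl, ite_false]
    show Real.exp (Real.log (|x₁| / Y)) * (hypPoint ε w) 1 = (entPoint ε (decide (0 < x₁)) (|x₁| • ‖w‖⁻¹ • w)) 1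
    rw [hexp, show (hypPoint ε w) 1 = (yfac ε w • w) 0 from rfl,
      show (entPoint ε (decide (0 < x₁)) (|x₁| • ‖w‖⁻¹ • w)) 1 = (|x₁| • ‖w‖⁻¹ • w) 0 from rfl]
    simp only [PiLp.smul_apply, smul_eq_mul]
    rw [← hyf]; field_simp
  · -- the `y₂`-coordinate
    simp only [Fin.reduceFinMk, Fin.isValue, Nat.not_ofNat_lt_one, ite_false]
    show Real.exp (Real.log (|x₁| / Y)) * (hypPoint ε w) 2 = (entPoint ε (decide (0 < x₁)) (|x₁| • ‖w‖⁻¹ • w)) 2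
    rw [hexp, show (hypPoint ε w) 2 = (yfac ε w • w) 1 from rfl,
      show (entPoint ε (decide (0 < x₁)) (|x₁| • ‖w‖⁻¹ • w)) 2 = (|x₁| • ‖w‖⁻¹ • w) 1 from rfl]
    simp only [PiLp.smul_apply, smul_eq_mul]
    rw [← hyf]; field_simp

end TracePolar

/-! ### The blow-up picture on `W` -/

namespace BasinPair

namespace SaddleData

open TracePolar

variable {W : Type u} [TopologicalSpace W] [T2Space W] [SecondCountableTopology W]
  [CompactSpace W] [ChartedSpace (EuclideanHalfSpace (2 + 1)) W] [IsManifold (𝓡∂ (2 + 1)) ∞ W]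
  {g : W → ℝ} {ξA ξB : Π x : W, TangentSpace (𝓡∂ (2 + 1)) x} {P : BasinPair g ξA ξB}
  {Q : P.SaddleData}

/-- Local notation for the model plane and space. -/
local notation "E2" => EuclideanSpace ℝ (Fin 2)
local notation "E3" => EuclideanSpace ℝ (Fin 3)

/-- **The passage on `W`**: the trajectory of the flow-polar point of `s` with coordinates `w`
(`‖w‖ ≠ 1`) passes, at the model time, through the entrance-sheet point of the end `b = (1 < ‖w‖)`
with transverse coordinate `|x₁(w)| · w/‖w‖`. [cite: MilnorHCobordism1965, proof of Thm. 3.12 (PDF p. 18)] -/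
theorem θ_polW_eq_entW {s : SaddlePt 2 g} (hk : (Q.DA s).k = 1) {w : E2} (hw : w ∈ Q.polTarget) (h1 : ‖w‖ ≠ 1) :
    P.A.θ (Real.log (|xco Q.ε w| / ‖yv (hypPoint Q.ε w)‖), Q.polW s w) =
      Q.entW s (decide (1 < ‖w‖)) (|xco Q.ε w| • ‖w‖⁻¹ • w) := by
  have hε := Q.ε_pos
  have hx : xco Q.ε w ≠ 0 := fun h => h1 ((xco_eq_zero_iff hε hw.1).1 h)
  obtain ⟨hball, hcoord⟩ := polW_mem_chartBall (Q := Q) (s := s) hw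
  set t := Real.log (|xco Q.ε w| / ‖yv (hypPoint Q.ε w)‖) with ht
  have hmodel : milnorFlow (Q.DA s).k t ((Q.DA s).coord (Q.polW s w)) =
      entPoint Q.ε (decide (1 < ‖w‖)) (|xco Q.ε w| • ‖w‖⁻¹ • w) := by
    rw [hcoord, hk, ht, milnorFlow_hypPoint_eq_entPoint hε hw.1 hx, show decide (0 < xco Q.ε w) = decide (1 < ‖w‖) from
      by rw [decide_eq_decide]; exact xco_pos_iff hε hw.1]
  have hy : ‖|xco Q.ε w| • ‖w‖⁻¹ • w‖ ^ 2 < Q.ε ^ 2 := by rw [norm_abs_xco_smul hw.1, sq_abs]; exact hw.2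
  have hnorm : ‖milnorFlow (Q.DA s).k t ((Q.DA s).coord (Q.polW s w))‖ < 3 * (Q.DA s).ε := by
    rw [hmodel, Q.εA]; exact norm_entPoint_lt hε _ hy
  have hball' : Q.polW s w ∈ (Q.DA s).chartBall (3 * (Q.DA s).ε) := by rw [Q.εA]; exact hball
  have hc := (Q.DA s).coord_flow P.A.isSmoothFlow_X P.A.contMDiff_X hball' hnorm
  have hb := (Q.DA s).flow_mem_chartBall P.A.isSmoothFlow_X P.A.contMDiff_X hball' hnorm
  rw [hmodel] at hc
  -- same coordinates in the chart ball
  have h2 := (Q.DA s).pt_coord_of_mem_chartBall hb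
  rw [hc] at h2
  rw [← h2]
  rfl

variable [Nonempty (BoundaryManifold.boundaryData 2 W).carrier]

/-- A flow-polar boundary point off the unit circle lies off the traces, in the domain of the
planarisation. [folklore] -/
theorem pol_mem_planarDom {s : SaddlePt 2 g} (hk : (Q.DA s).k = 1) {w : E2} (hw : w ∈ Q.polTarget) (h1 : ‖w‖ ≠ 1) :
    Q.pol s w ∈ P.A.planarDom := by
  rw [BasinSetting.mem_planarDom_iff, BasinSetting.mem_traces_iff_exists_traceOf]
  rintro ⟨s', hs'⟩
  have hsrc : Q.pol s w ∈ Q.polSource s := pol_mem_polSource hk hw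
  have hsrc' : Q.pol s w ∈ Q.polSource s' := Q.traceOf_subset_polSource s' hs'
  have hss : s = s' := by
    by_contra hne
    exact Set.disjoint_left.1 (Q.disjoint_polSource hne) hsrc hsrc'
  subst hss
  exact h1 ((Q.pol_mem_traceOf_iff hk hw).1 hs')

/-- **The blow-up picture**: read through the flow-polar chart of `s`, the planarisation is
`w ↦ entDir s b (|x₁(w)| · w/‖w‖)` with `b = (1 < ‖w‖)` — the collars of the unit circle are
blown down onto the two core directions of `s`. [cite: MilnorHCobordism1965, Def. 3.9, proof of Thm. 3.12, Thm. 4.1] -/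
theorem planar_pol {s : SaddlePt 2 g} (hk : (Q.DA s).k = 1) {w : E2} (hw : w ∈ Q.polTarget) (h1 : ‖w‖ ≠ 1) :
    P.A.planar (Q.pol s w) = Q.entDir s (decide (1 < ‖w‖)) (|xco Q.ε w| • ‖w‖⁻¹ • w) := by
  have hdom := pol_mem_planarDom hk hw h1
  set z := Q.polW s w with hz
  have hreg : ¬ IsMCriticalPt (𝓡∂ (2 + 1)) g z :=
    Q.not_isMCriticalPt_of_apply (apply_polW_mem_Ioo hk hw).1 (by rw [apply_polW hk hw, exitLevel]; linarith [Q.sq_pos])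
  -- the push of `pol s w` is the top of `z`, and its trajectory meets the small level sphere
  have hpush : P.A.push (Q.pol s w : W) = P.A.top z := push_pol hk hw
  have hhit_top : Hits P.A.θ g P.A.sphR (P.A.top z) := by rw [← hpush]; exact hdom
  have hhit : Hits P.A.θ g P.A.sphR z := by rw [BasinSetting.top_def] at hhit_top; exact (P.A.hits_θ_iff _ _ _).1 hhit_top
  have hslab := P.A.Ioo_subset_slab P.A.sphR_mem_Ioo
  rw [BasinSetting.planar, BasinSetting.low, hpush, BasinSetting.top_def, P.A.levelProj_θ hreg hslab hhit,
    ← P.A.levelProj_θ hreg hslab hhit (Real.log (|xco Q.ε w| / ‖yv (hypPoint Q.ε w)‖)), hz, θ_polW_eq_entW hk hw h1]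
  rfl

end SaddleData

end BasinPair

end Literature.Topology.FourManifolds
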